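import Literature.NumberTheory.LFunctions.WeilTwoPrimeOddMarginHBase
import Literature.NumberTheory.LFunctions.WeilTwoPrimeOddMarginHDataP22
import Literature.NumberTheory.LFunctions.WeilBlockRowsP
import HarnessLib

/-!
# Two-prime odd-margin certificate H: the materialized block agrees with `P_r`, rows 120–127

`WeilCert.checkPmRow` (row `k` of the claim `Pm_{kl} = P_r(2k+1, 2l+1)`) for certificate H, by `decide +kernel`. Pure proof file; nothing is asserted.
-/

noncomputable section

namespace Literature.NumberTheory.LFunctions

set_option maxHeartbeats 0 in
/-- Row 120 of the materialized block is row 120 of `P_r` (certificate H). [folklore] -/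
theorem checkPmRow1_120_weilCert23H : weilCert23HBase.checkPmRow weilCert23HNu weilCert23HPm 1 120 = true := by
  decide +kernel

set_option maxHeartbeats 0 in
/-- Row 121 of the materialized block is row 121 of `P_r` (certificate H). [folklore] -/
theorem checkPmRow1_121_weilCert23H : weilCert23HBase.checkPmRow weilCert23HNu weilCert23HPm 1 121 = true := by
  decide +kernel

set_option maxHeartbeats 0 in
/-- Row 122 of the materialized block is row 122 of `P_r` (certificate H). [folklore] -/
theorem checkPmRow1_122_weilCert23H : weilCert23HBase.checkPmRow weilCert23HNu weilCert23HPm 1 122 = true := by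
  decide +kernel

set_option maxHeartbeats 0 in
/-- Row 123 of the materialized block is row 123 of `P_r` (certificate H). [folklore] -/
theorem checkPmRow1_123_weilCert23H : weilCert23HBase.checkPmRow weilCert23HNu weilCert23HPm 1 123 = true := by
  decide +kernel

set_option maxHeartbeats 0 in
/-- Row 124 of the materialized block is row 124 of `P_r` (certificate H). [folklore] -/
theorem checkPmRow1_124_weilCert23H : weilCert23HBase.checkPmRow weilCert23HNu weilCert23HPm 1 124 = true := by
  decide +kernel

set_option maxHeartbeats 0 in
/-- Row 125 of the materialized block is row 125 of `P_r` (certificate H). [folklore] -/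
theorem checkPmRow1_125_weilCert23H : weilCert23HBase.checkPmRow weilCert23HNu weilCert23HPm 1 125 = true := by
  decide +kernel

set_option maxHeartbeats 0 in
/-- Row 126 of the materialized block is row 126 of `P_r` (certificate H). [folklore] -/
theorem checkPmRow1_126_weilCert23H : weilCert23HBase.checkPmRow weilCert23HNu weilCert23HPm 1 126 = true := by
  decide +kernel

set_option maxHeartbeats 0 in
/-- Row 127 of the materialized block is row 127 of `P_r` (certificate H). [folklore] -/
theorem checkPmRow1_127_weilCert23H : weilCert23HBase.checkPmRow weilCert23HNu weilCert23HPm 1 127 = true := by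
  decide +kernel


end Literature.NumberTheory.LFunctions
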